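import Literature.MathematicalPhysics.QuantumFieldTheory.BalabanImbrieJaffe1984to88.BIJ85Ineq732FlatRegion
import Literature.MathematicalPhysics.QuantumFieldTheory.BalabanImbrieJaffe1984to88.BIJ88DeltaLocFlatClose235
import Literature.MathematicalPhysics.QuantumFieldTheory.BalabanImbrieJaffe1984to88.BIJ88Ineq238Proof

/-!
# `BalabanImbrieJaffe1984to88.BIJ88Ineq238FlatTorus` — T. Bałaban, J. Imbrie, A. Jaffe, *Effective action and cluster properties of the
abelian Higgs model*, Commun. Math. Phys. **114** (1988) 257–315 [BalabanImbrieJaffe1988], Sect. 2 p. 264 [PDF 8]: **(2.38) AT EVERY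
PURE-GAUGE BACKGROUND `u = 1^h` FOR THE TORUS OBJECT OF RECORD `Δ_{k,loc}(u)`** (gen 15's `BIJ88DeltaLoc234Torus.deltaLocT`, (2.34) with
body) — the printed hence-step *"in view of (2.35), the lower bound (I.7.3.2) applies to Δ_{k,loc}(u) as well"* run on its two inputs FOR THE
CONCRETE OBJECTS: (I.7.3.2) for the region form `Δ_k(Ω₀,1^h)` (companion `BIJ85Ineq732FlatRegion.ineq732_pureGauge_region_of`, this seat, file
1 of 2) and (2.35) at flat backgrounds (gen 17's `BIJ88DeltaLocFlatClose235.close235_flat_level`), assembled by p02's abstract hence-step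
`BIJ88Ineq238Proof.ineq238_loc_of_kernelClose` BY NAME — hypothesis-free in [6], constants from `(d, L, a)` only, every volume, `1 ≤ k ≤ K`.

statement-level skeleton of published theorems with citation tags; proofs where landed; nothing here is a claim about the Yang–Mills mass gap

PDF held: `paper:balaban1988-cmp114-bij-abelian-higgs-effective-action` (journal page = PDF page + 256); p. 263–264 [PDF 7–8] re-read this
session as images (renders `HOME/lit-balaban-p31/renders/original-p007-x2.png`, `original-p008-x2.png`); [I] = [BalabanImbrieJaffe1985]
(CMP **97**) p. 326 (7.3.2) as quoted in the companion file.

CITATION HEADER (lean-in-tree rule).  Part of the lit-balaban TYPED SKELETON (HOME `run/shared/lean/pub/lit-balaban/`), PHASE-2 proof seat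
p31 gen 18 (unit `lit-balaban-p31-g18`; TAKING line HOME/STATUS.md 2026-08-22T17:38:58Z; free-target protocol G.5-34(d) — item 2 (ii) of
the owner's `HOME/lit-balaban-r18/C2S14-CLOSURE.md` §5, *"(2.30)/(2.31) ⟹ (2.35)/(2.36)/(2.38)/(2.41)/(4.9)_{j≥1} as torus theorems"*, the
(2.38) member at FLAT BACKGROUNDS; successor item (b) of this seat's gen-17 HANDOFF; file 2 of 2).  WHAT IS REPRODUCED: row **C2.Eq2.38**
(`HOME/lit-balaban-r18/ROWS-C2.md`, owner r18; head = p02's abstract hence-step `BIJ88Ineq238Proof` (p02 g3 p248488), whose inputs (I.7.3.2)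
and (2.35) are displayed hypotheses — r18's `BIJ88Sect2Statements.Ineq238 …` and a kernel closeness) for the CONCRETE torus object
`Δ_{k,loc}(1^h)` WITH BODY, kind «model-level theorem at flat backgrounds» (no definition, no `Prop`-valued fact introduced).

THE PRINTED TEXT (verbatim).  p. 264 [PDF 8]: *"Again we assume u is smooth in the relevant regions; Δ_{k,loc}(u; x₁,x₂) depends on u only
in an O(r(e_k))-neighborhood of x₁, x₂. Finally, in view of (2.35), the lower bound (I.7.3.2) applies to Δ_{k,loc}(u) as well. Let φ be
supported in a region having an r(e_k) neighborhood where u is smooth. Then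
⟨φ, Δ_{k,loc}(u)φ⟩ ≧ c Σ_{b∈T₁^{(k)*}} |u(⟨b₋,b₊⟩)φ(b₊) − φ(b₋)|² − ce_k²p(e_k)² Σ_{x∈T₁^{(k)}} |φ(x)|². (2.38)"*; p. 263 [PDF 7]: *"Δ_{k,loc}(u) =
a_kI − a_k²Q_k(u)G_{k,loc}(u)Q_k*(u). (2.34) Here we have simply replaced G_k(Ω,u) with G_{k,loc} in the definition of Δ_k(Ω,u); see (I.4.6.4).
Hence |Δ_{k,loc}(u;x₁,x₂) − Δ_k(Ω,u;x₁,x₂)| ≦ e^{−cr(e_k)}e^{−c|x₁−x₂|} for dist({x₁,x₂},Ω^c) > O(r(e_k)), (2.35)"*.  [I] p. 326 (7.3.2):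
*"⟨φ, Δ_k(u_k)φ⟩ ≥ γ Σ_{b∈T₁^{(k)}} |u_k(b)φ(b₊) − φ(b₋)|² − Me_k^{2−α} Σ_{x∈T₁^{(k)}} |φ(x)|²"*.

THE OBJECTS AND THE NORMALIZATION (gen 15–17, unchanged).  `Δ_{k,loc}(1^h) = deltaLocT A ε^{−1} (1^h) k cube λ ζ″ = A·1 − A²·Q_k(1^h)G_{k,loc}(1^h)Q_k(1^h)ᴴ`
on `ℓ²(T^{(k)})` (`T^{(k)} = Site P (0+k)`), `Δ_k(Ω₀,1^h) = deltaRegion A ε^{−1} (1^h) k Ω₀`, `A = α_kL^{kd}`, `α_k = a_k(L^kε)^{−2}`, `a_k = B1.aSeq a L k`,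
`Ω₀ = cubeT hPd (L^k) c (L^kM₀)` the no-wrap box of gen 17's (2.35), the cubes `□_α` NESTED in `Ω₀`, the weights `λ_α` and the cut-off `ζ″`
DATA (gen 15).  In this counting normalization `deltaLocT`/`deltaRegion` are `A/a_k = L^{kd}(L^kε)^{−2}` times the printed kernels (gen 17's
header), so the printed constants appear below multiplied by `A/a_k`, exactly as in `close235_flat_level`.  `u_k(b) = h(b₋)h(b₊)^{−1}` (read at
the corner points `cornerIter k`) = the transport of `1^h` along the unit bond `b` = p11's `lineIter (1^h) k b` ((4.4) *"ū_{k,b} =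
u_k(⟨b₋, b₊⟩)"*).  `|y₁−y₂|_{T^{(k)}} = B5Ineq137Torus.T P (0+k)` the sup torus distance of the unit lattice.

THE MECHANISM (p02's printed hence-step, for the concrete objects).  (a) (I.7.3.2) ON THE BOX: `Ω₀` is a union of `k`-blocks (gen 16's
`isBlockUnion_cubeT`), so the companion's `ineq732_pureGauge_region_of` gives `γ_A·Σ_{b∈Ω₀^{(k)*}}|u_k(b)φ(b₊) − φ(b₋)|² ≤ Re φᴴΔ_k(Ω₀,1^h)φ`
with `γ_A = (A/a_k)·min(a_k/(8d), ½)` (`8dγ_A ≤ A`, `2n²γ_A ≤ Nε^{−2} = 2n²·(A/a_k)/2`); for admissible `φ` every unit bond meeting `supp φ`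
lies in `Ω₀^{(k)*}` (print: *"φ supported in a region having an r(e_k) neighborhood where u is smooth"*), so the sum is the printed
`Σ_{b∈T₁^{(k)*}}` and r18's `Ineq238 γ_A 0 0 (kform Δ_k(Ω₀,1^h)) Adm u_k` is INHABITED (`e_k`-term zero: no field strength at a pure gauge).
(b) (2.35): gen 17's `close235_flat_level` bounds `‖Δ_{k,loc}(1^h;y₁,y₂) − Δ_k(Ω₀,1^h;y₁,y₂)‖ ≤ δ·e^{−(δ₀/2)|y₁−y₂|_{T^{(k)}}}`,
`δ = A·a_k·c₀(#S·e^{−2δ₀R/L^k} + e^{−(δ₀/2)R₁/L^k})`, on every row `y₁ ∈ supp φ` under its hypotheses (i)–(iii) + (S) — p02's kernel-closeness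
hypothesis on `supp φ × supp φ`.  (c) The torus row sum `Σ_{y₂}e^{−(δ₀/2)|y₁−y₂|_{T^{(k)}}} ≤ K_d(δ₀/2)` (`B5Ineq137Torus.rowSum_T_le`,
volume-uniform).  (d) `ineq238_loc_of_kernelClose` concludes: `γ_A·Σ_b|u_k(b)φ(b₊) − φ(b₋)|² − δK_d·Σ_x|φ(x)|² ≤ kform Δ_{k,loc}(1^h) φ =
Re φᴴΔ_{k,loc}(1^h)φ` (`kform_eq_re_dotProduct`), and `δK_d = (A/a_k)·a_k²c₁(…)`, `c₁ = c₀K_d(δ₀/2)`.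

WHAT IS PROVED (theorems only; 0 `sorry`; standard axioms; no new definition, no `Prop`-valued fact).
* `kform_eq_re_dotProduct` (p02's `kform K φ = Re φᴴKφ` for a matrix `K`), `sum_univ_eq_sum_starB`, `aSeq_ge` (`a(1 − L^{−2}) ≤ a_k`, `k ≥ 1`:
  the constant below is `≥ min(a(1−L^{−2})/(8d), ½)` uniformly in `k`).
* **`ineq238_flat`** — `∃ δ₀ c₁ > 0` (from `(d, ℓ, a)`) ∀ volumes `P` (`P.d = d+1`, `P.L = ℓ+1`) ∀ `1 ≤ k ≤ K` ∀ no-wrap boxes `Ω₀` fitting and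
  shorter than the torus ∀ finite families of cubes nested in `Ω₀` with `Σ_α|λ_α| ≤ 1`, `0 ≤ ζ″ ≤ 1` ∀ `h` ∀ `R, R₁ ≥ 0` ∀ `S` ∀ admissibility
  predicates `Adm` such that admissible `φ` satisfy gen 17's (2.35) row hypotheses (i) `ζ″ ≠ 0 ⟹ Σ_αλ_α = 1`, (ii) active cubes contain the
  row and column sites at sup-torus depth `≥ R` inside `Ω₀`, (iii) `ζ″ = 1` within `R₁`, (S) active cubes `∈ S`, on every block `B^k(y₁)`,
  `y₁ ∈ supp φ`, AND «every unit bond meeting `supp φ` lies in `Ω₀^{(k)*}`» — ∀ admissible `φ`: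
  `(A/a_k)·( min(a_k/(8d), ½)·Σ_{b∈T₁^{(k)*}}|u_k(b)φ(b₊) − φ(b₋)|² − a_k²c₁(#S·e^{−2δ₀R/L^k} + e^{−(δ₀/2)R₁/L^k})·Σ_x|φ(x)|² ) ≤ Re φᴴΔ_{k,loc}(1^h)φ`
  — at the printed radii `R, R₁ = r(e_k)L^k` the bracket is `e^{−cr(e_k)}` AT EVERY LEVEL `k` (gen 17's level-`k` units).
* v1.1 **`ineq238_flat_mult`** — the same with the global label set `S` replaced by a PER-ROW MULTIPLICITY `m` (on each block row the
  active cubes lie in some set of `≤ m` labels; error `a_k²c₁(m·e^{−2δ₀R/L^k} + e^{−(δ₀/2)R₁/L^k})`); `ineq238_flat` is its case `m = #S`.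
HONEST SCOPE.  (i) FLAT / PURE-GAUGE BACKGROUNDS ONLY: print's `−ce_k²p(e_k)²Σ|φ|²` is the field-strength term of (I.7.3.2) for a
(2.32)-smooth `u`; at `u = 1^h` it is absent and NOTHING is claimed for general `u` (the (2.32)-smooth case is XL — gen 16; p11's G-C1-05).
(ii) p02's TWO-CONSTANT reading (HOME/GAPS.md, `BIJ88Ineq238Proof` header): the (2.35) error `a_k²c₁e^{−cr(e_k)}Σ|φ|²` is carried as the
explicit second constant, not absorbed into a one-letter `c`.  (iii) `Ω` of (2.35) = a no-wrap box `Ω₀` shorter than the torus (gen 17's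
scope: the tree's zero-field `δG` theorem is for nested boxes); the radii `R, R₁`, the multiplicity set `S` / bound `m` and the admissibility
region are properties of the DATA `λ_α`, `ζ″` and enter as hypotheses, exactly as in gen 17 (the torus instance of p13's `ℤ^d` weights that
discharges them is the successor file `BIJ88LocData227Torus`).  (iv) Value statement for `Re φᴴΔ_{k,loc}φ` (the form of the Hermitian `Δ_{k,loc}(1^h)` is real; not re-proved here).  (v) `j = 0`,
`1 ≤ k ≤ K`, `m² = 0`, window `a₋ = a₊ = a`; constants not optimized.  (vi) (2.41)/(4.9)_{j≥1} (the Dirichlet inverse `C^{(k)}_Λ` of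
(2.39)/(2.40)) are NOT here.
Imports: the companion `BIJ85Ineq732FlatRegion` (this seat, same gen), gen 17's `BIJ88DeltaLocFlatClose235`, p02's `BIJ88Ineq238Proof`.
Literature + Mathlib only.  Unit `lit-balaban-p31` (literature-prover-lit-balaban-p31-g18-0), 2026-08-22; v1.1 (same seat): `ineq238_flat_mult` (per-row multiplicity `m` in place of
one global label set `S`; `ineq238_flat` re-derived from it, statement unchanged).  NOT summit progress.
-/

open scoped BigOperators Matrix ComplexConjugate
open Finset Matrix

namespace Literature.MathematicalPhysics.QuantumFieldTheory.BalabanImbrieJaffe1984to88.BIJ88Ineq238FlatTorus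

open Literature.MathematicalPhysics.QuantumFieldTheory.Balaban1983to89
open BIJ88Sect3Statements (U1 toC cfg covD starB mem_starB toC_mul toC_one toC_inv norm_toC)
open BIJ85BlockAveragesTorus BIJ85BlockAveragesTorusK
open BIJ88NeumannNoZeroModesTorus (IsBlockUnion innerK mem_innerK)
open BIJ88NeumannPropagator227Torus
open BIJ88DeltaLoc234Torus (deltaLocT deltaRegion)
open BIJ85Ineq732FlatRegion (ineq732_pureGauge_region_of)
open GaugeField (gaugeAct)

noncomputable section

variable {P : Params}

/-! ## §6 **(2.38) AT FLAT BACKGROUNDS for gen 15's `Δ_{k,loc}(1^h)`**: §5 on the box `Ω₀` and gen 17's (2.35), fed into p02's hence-step -/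

section Flat238

open BIJ88NeumannPropagatorFlatDecayCube (cubeT isBlockUnion_cubeT)
open BIJ88DeltaLocFlatClose235 (close235_flat_level)
open BIJ88Ineq238Proof (kform ineq238_loc_of_kernelClose)
open BIJ88Sect2Statements (Ineq238)
open B5Ineq137Torus (T T_symm rowSum_T_le)
open B4Sect5Proof (latticeConst latticeConst_nonneg)

variable {d : ℕ}

/-- kernel: p02's quadratic form `kform K φ = Re Σ_{x,y} conj(φ(x))K(x,y)φ(y)` IS `Re ⟨φ, Kφ⟩ = Re(φᴴ(Kφ))` of the matrix `K`.
[cite: BalabanImbrieJaffe1988, (2.38) p.264] -/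
theorem kform_eq_re_dotProduct {α : Type*} [Fintype α] (K : Matrix α α ℂ) (φ : α → ℂ) :
    kform K φ = (star φ ⬝ᵥ (K *ᵥ φ)).re := by
  rw [kform, dotProduct, Complex.re_sum]
  refine sum_congr rfl fun x _ => ?_
  rw [Pi.star_apply, mulVec, dotProduct, mul_sum, Complex.re_sum]
  refine sum_congr rfl fun y _ => ?_
  rw [Complex.star_def, mul_assoc]

/-- kernel: a bond sum whose summand vanishes off `X*` is the sum over `X*`. [cite: BalabanImbrieJaffe1988, (2.38) p.264] -/
theorem sum_univ_eq_sum_starB {i : ℕ} (X : Finset (Balaban1983to89.Site P i)) (F : PBond P i → ℝ)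
    (hF : ∀ b, b ∉ starB X → F b = 0) : ∑ b : PBond P i, F b = ∑ b ∈ starB X, F b :=
  (Finset.sum_subset (subset_univ _) fun b _ hb => hF b hb).symm

/-- kernel: `K_d(a) > 0` for `a > 0` (the torus row-sum constant of `B5Ineq137Torus.rowSum_T_le`). [folklore] -/
private theorem latticeConst_pos (d : ℕ) {a : ℝ} (ha : 0 < a) : 0 < latticeConst d a := by
  unfold latticeConst
  rcases Nat.eq_zero_or_pos d with hd | hd
  · subst hd; simp
  · have hd' : (0 : ℝ) < d := Nat.cast_pos.2 hd
    have h1 : Real.exp (-(a / d)) < 1 := Real.exp_lt_one_iff.2 (by rw [neg_lt_zero]; positivity)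
    have h2 : 0 < 1 - Real.exp (-(a / d)) := by linarith
    positivity

/-- kernel: `a(1 − L^{−2}) ≤ a_k` for `k ≥ 1`, `L > 1` (the printed coefficient of [I] (4.6.2), `a_k = a(1−L^{−2})(1−L^{−2k})^{−1}`; lower
bound uniform in `k`). [cite: BalabanImbrieJaffe1985, (4.6.2) p.313] -/
theorem aSeq_ge {a L : ℝ} (ha : 0 ≤ a) (hL : 1 < L) {k : ℕ} (hk : 1 ≤ k) : a * (1 - (L ^ 2)⁻¹) ≤ B1.aSeq a L k := by
  rw [B1.aSeq_eq]
  have hL2 : 1 < L ^ 2 := by nlinarith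
  have hr0 : 0 < (L ^ 2)⁻¹ := by positivity
  have hr1 : (L ^ 2)⁻¹ < 1 := inv_lt_one_of_one_lt₀ hL2
  have hpk : ((L ^ 2)⁻¹) ^ k ≤ (L ^ 2)⁻¹ := by
    calc ((L ^ 2)⁻¹) ^ k ≤ ((L ^ 2)⁻¹) ^ 1 := pow_le_pow_of_le_one hr0.le hr1.le hk
      _ = (L ^ 2)⁻¹ := pow_one _
  have hden : 0 < 1 - ((L ^ 2)⁻¹) ^ k := by linarith
  have hden1 : 1 - ((L ^ 2)⁻¹) ^ k ≤ 1 := by linarith [pow_nonneg hr0.le k]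
  have hnum : 0 ≤ a * (1 - (L ^ 2)⁻¹) := mul_nonneg ha (by linarith)
  rw [le_div_iff₀ hden]
  calc a * (1 - (L ^ 2)⁻¹) * (1 - ((L ^ 2)⁻¹) ^ k) ≤ a * (1 - (L ^ 2)⁻¹) * 1 := mul_le_mul_of_nonneg_left hden1 hnum
    _ = a * (1 - (L ^ 2)⁻¹) := mul_one _

/-- **(2.38) AT EVERY PURE-GAUGE BACKGROUND `u = 1^h` FOR GEN 15's `Δ_{k,loc}(1^h)`, WITH A PER-ROW MULTIPLICITY** (v1.1): the statement
of `ineq238_flat` below with the one global label set `S` replaced by a multiplicity bound `m` — on every block row `B^k(y₁)`, `y₁ ∈ supp φ`, the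
active cubes (`ζ″λ_α ≠ 0`) lie in SOME label set of at most `m` elements (print: *"at most 2^d terms"* per pair, p. 263; for the (2.27) data
on the torus `m = 3^{d+1}` per block row, `BIJ88LocData227Torus`) — so that the (2.35) error `a_k²c₁(m·e^{−2δ₀R/L^k} + e^{−(δ₀/2)R₁/L^k})` is
uniform in the support of `φ`; p02's hence-step `ineq238_loc_of_kernelClose` BY NAME exactly as in `ineq238_flat`.
[cite: BalabanImbrieJaffe1988, (2.38) p.264] -/
theorem ineq238_flat_mult (d ℓ : ℕ) (hℓ : 1 ≤ ℓ) {a : ℝ} (ha : 0 < a) :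
    ∃ δ₀ c₁ : ℝ, 0 < δ₀ ∧ 0 < c₁ ∧ ∀ (P : Params) (hPd : P.d = d + 1), P.L = ℓ + 1 →
      ∀ k : ℕ, 1 ≤ k → k ≤ P.K → ∀ (c M0 : Fin (d + 1) → ℕ), (∀ i, 1 ≤ M0 i) →
        (∀ i, c i * P.L ^ k + P.L ^ k * M0 i ≤ P.sitesPerDir 0) → (∀ i, P.L ^ k * M0 i < P.sitesPerDir 0) →
      ∀ (ι : Type) [Fintype ι] (cube : ι → Finset (Balaban1983to89.Site P 0))
        (lam : ι → Balaban1983to89.Site P 0 → Balaban1983to89.Site P 0 → ℝ)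
        (ζ'' : Balaban1983to89.Site P 0 → Balaban1983to89.Site P 0 → ℝ),
        (∀ α, ∃ t M : Fin (d + 1) → ℕ, (∀ i, 1 ≤ M i) ∧ (∀ i, t i + M i ≤ M0 i) ∧
            cube α = cubeT hPd (P.L ^ k) (c + t) fun i => P.L ^ k * M i) →
        (∀ x y, ∑ α, |lam α x y| ≤ 1) → (∀ x y, 0 ≤ ζ'' x y ∧ ζ'' x y ≤ 1) →
      ∀ (h : GaugeTransf P 0 U1) (R R₁ : ℝ), 0 ≤ R → 0 ≤ R₁ → ∀ (m : ℕ)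
        (Adm : (Balaban1983to89.Site P (0 + k) → ℂ) → Prop),
        (∀ φ, Adm φ → ∀ y₁, φ y₁ ≠ 0 →
          (∀ x ∈ blockK k y₁, ∀ y, ζ'' x y ≠ 0 → ∑ α, lam α x y = 1) ∧
          (∀ x ∈ blockK k y₁, ∀ α y, ζ'' x y * lam α x y ≠ 0 → x ∈ cube α ∧ y ∈ cube α ∧
              ∀ w ∈ cubeT hPd (P.L ^ k) c (fun i => P.L ^ k * M0 i), w ∉ cube α →
                R ≤ B5Ineq137Torus.T P 0 x w ∧ R ≤ B5Ineq137Torus.T P 0 y w) ∧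
          (∀ x ∈ blockK k y₁, ∀ y, B5Ineq137Torus.T P 0 x y ≤ R₁ → ζ'' x y = 1) ∧
          ∃ S : Finset ι, S.card ≤ m ∧ ∀ x ∈ blockK k y₁, ∀ α y, ζ'' x y * lam α x y ≠ 0 → α ∈ S) →
        (∀ φ, Adm φ → ∀ b : PBond P (0 + k), (φ b.src ≠ 0 ∨ φ b.tgt ≠ 0) →
          b ∈ starB (innerK k (cubeT hPd (P.L ^ k) c fun i => P.L ^ k * M0 i))) →
      ∀ φ, Adm φ →
        (B1RG242Torus.α P a k * (P.L : ℝ) ^ (k * P.d)) / B1.aSeq a P.L k *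
          (min (B1.aSeq a P.L k / (8 * P.d)) (1 / 2) *
              ∑ b : PBond P (0 + k), ‖toC (h (cornerIter k b.src)) * (toC (h (cornerIter k b.tgt)))⁻¹ * φ b.tgt - φ b.src‖ ^ 2
            - B1.aSeq a P.L k ^ 2 * c₁ *
              ((m : ℝ) * Real.exp (-(δ₀ * (((P.L : ℝ) ^ k)⁻¹ * (2 * R)))) + Real.exp (-(δ₀ / 2 * (((P.L : ℝ) ^ k)⁻¹ * R₁)))) *
              ∑ y : Balaban1983to89.Site P (0 + k), ‖φ y‖ ^ 2)
        ≤ (star φ ⬝ᵥ (deltaLocT (B1RG242Torus.α P a k * (P.L : ℝ) ^ (k * P.d)) P.eps⁻¹ (gaugeAct h (1 : GaugeField P 0 U1)) k cube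
            lam ζ'' *ᵥ φ)).re := by
  obtain ⟨δ₀, c₀, hδ₀, hc₀, H⟩ := close235_flat_level d ℓ hℓ ha
  refine ⟨δ₀, c₀ * latticeConst (d + 1) (δ₀ / 2), hδ₀, mul_pos hc₀ (latticeConst_pos (d + 1) (half_pos hδ₀)), ?_⟩
  intro P hPd hPL k hk1 hkK c M0 hM0 hfit0 hN0 ι _ cube lam ζ hcube hlam hζ h R R₁ hR hR₁ m Adm hAdm hnb φ hφ
  have hk : 0 + k ≤ P.m + P.K := by omega
  -- the objects and the constants
  set Ω₀ : Finset (Balaban1983to89.Site P 0) := cubeT hPd (P.L ^ k) c fun i => P.L ^ k * M0 i with hΩ₀def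
  have hΩ₀ : IsBlockUnion k Ω₀ := isBlockUnion_cubeT hPd (by omega) rfl hfit0
  set A : ℝ := B1RG242Torus.α P a k * (P.L : ℝ) ^ (k * P.d) with hAdef
  set ak : ℝ := B1.aSeq a P.L k with hakdef
  have hak : 0 < ak := B1.aSeq_pos ha (B1RG242Torus.one_lt_cast_L P) hk1
  have hLpos : (0 : ℝ) < P.L := P.cast_L_pos
  have hLk : (0 : ℝ) < (P.L : ℝ) ^ k := pow_pos hLpos _
  have hLkd : (0 : ℝ) < (P.L : ℝ) ^ (k * P.d) := pow_pos hLpos _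
  have heps : 0 < P.eps := P.eps_pos
  have hspp : 0 < P.spacing k := P.spacing_pos k
  have hd : (0 : ℝ) < P.d := Nat.cast_pos.2 P.hd
  have hsp : P.spacing k = (P.L : ℝ) ^ k * P.eps := rfl
  have hα : B1RG242Torus.α P a k = ak * (P.spacing k ^ 2)⁻¹ := rfl
  have hA0 : 0 < A := by rw [hAdef, hα]; positivity
  have hAak : A / ak = (P.L : ℝ) ^ (k * P.d) * (((P.L : ℝ) ^ k * P.eps) ^ 2)⁻¹ := by
    rw [hAdef, hα, hsp]
    field_simp
  -- the bracket of (2.35) and the kernel closeness constant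
  set br : ℝ := (m : ℝ) * Real.exp (-(δ₀ * (((P.L : ℝ) ^ k)⁻¹ * (2 * R)))) + Real.exp (-(δ₀ / 2 * (((P.L : ℝ) ^ k)⁻¹ * R₁)))
    with hbrdef
  have hbr0 : 0 ≤ br := by rw [hbrdef]; positivity
  set δ' : ℝ := A * (ak * c₀ * br) with hδ'def
  have hδ'0 : 0 ≤ δ' := by rw [hδ'def]; positivity
  set Kd : ℝ := latticeConst P.d (δ₀ / 2) with hKddef
  have hKdPd : latticeConst (d + 1) (δ₀ / 2) = Kd := by rw [hKddef, hPd]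
  -- the lower-bound constant in the counting normalization
  set γA : ℝ := A / ak * min (ak / (8 * P.d)) (1 / 2) with hγAdef
  have hγA0 : 0 ≤ γA := by rw [hγAdef]; positivity
  have hγ1 : γA * (8 * P.d) ≤ A := by
    have hm := min_le_left (ak / (8 * P.d)) (1 / 2)
    calc γA * (8 * P.d) = A / ak * (min (ak / (8 * P.d)) (1 / 2) * (8 * P.d)) := by rw [hγAdef]; ring
      _ ≤ A / ak * (ak / (8 * P.d) * (8 * P.d)) :=
          mul_le_mul_of_nonneg_left (mul_le_mul_of_nonneg_right hm (by positivity)) (by positivity)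
      _ = A := by field_simp
  have hγ2 : γA * (2 * ((P.L : ℝ) ^ k) ^ 2) ≤ (P.L : ℝ) ^ (k * P.d) * P.eps⁻¹ ^ 2 := by
    have hm := min_le_right (ak / (8 * P.d)) (1 / 2)
    calc γA * (2 * ((P.L : ℝ) ^ k) ^ 2) = A / ak * (min (ak / (8 * P.d)) (1 / 2) * (2 * ((P.L : ℝ) ^ k) ^ 2)) := by
          rw [hγAdef]; ring
      _ ≤ A / ak * (1 / 2 * (2 * ((P.L : ℝ) ^ k) ^ 2)) :=
          mul_le_mul_of_nonneg_left (mul_le_mul_of_nonneg_right hm (by positivity)) (by positivity)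
      _ = (P.L : ℝ) ^ (k * P.d) * P.eps⁻¹ ^ 2 := by rw [hAak]; field_simp
  -- (I.7.3.2) on the box for Δ_k(Ω₀,1^h): r18's `Ineq238 γA 0 0 (kform Δ_k(Ω₀,1^h)) Adm u_k`
  have h238 : Ineq238 γA 0 0 (kform (deltaRegion A P.eps⁻¹ (gaugeAct h (1 : GaugeField P 0 U1)) k Ω₀)) Adm
      fun b => toC (h (cornerIter k b.src)) * (toC (h (cornerIter k b.tgt)))⁻¹ := by
    intro ψ hψ
    beta_reduce
    have hreg := ineq732_pureGauge_region_of hk (inv_ne_zero heps.ne') hA0 hΩ₀ hγA0 hγ1 hγ2 h ψ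
    have hfull : ∑ b : PBond P (0 + k), ‖toC (h (cornerIter k b.src)) * (toC (h (cornerIter k b.tgt)))⁻¹ * ψ b.tgt - ψ b.src‖ ^ 2
        = ∑ b ∈ starB (innerK k Ω₀), ‖toC (h (cornerIter k b.src)) * (toC (h (cornerIter k b.tgt)))⁻¹ * ψ b.tgt - ψ b.src‖ ^ 2 := by
      refine sum_univ_eq_sum_starB (innerK k Ω₀) _ fun b hb => ?_
      have h0 : ψ b.src = 0 ∧ ψ b.tgt = 0 := by
        by_contra hne
        rw [not_and_or] at hne
        exact hb (hnb ψ hψ b hne)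
      rw [h0.1, h0.2, mul_zero, sub_zero, norm_zero, zero_pow two_ne_zero]
    rw [kform_eq_re_dotProduct, hfull]
    simpa using hreg
  -- (2.35): the kernel closeness on supp φ × supp φ
  have hM : ∀ ψ, Adm ψ → ∀ y₁ y₂, ψ y₁ ≠ 0 → ψ y₂ ≠ 0 →
      ‖deltaLocT A P.eps⁻¹ (gaugeAct h (1 : GaugeField P 0 U1)) k cube lam ζ y₁ y₂
          - deltaRegion A P.eps⁻¹ (gaugeAct h (1 : GaugeField P 0 U1)) k Ω₀ y₁ y₂‖
        ≤ δ' * Real.exp (-(δ₀ / 2) * B5Ineq137Torus.T P (0 + k) y₁ y₂) := by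
    intro ψ hψ y₁ y₂ hy₁ _
    obtain ⟨hcomp, hdeep, hcut, S, hSm, hS⟩ := hAdm ψ hψ y₁ hy₁
    have h35 := H P hPd hPL k hk1 hkK c M0 hM0 hfit0 hN0 ι cube lam ζ hcube hlam hζ h R R₁ hR hR₁ y₁ y₂ hcomp hdeep hcut S hS
    rw [neg_mul]
    rw [← hAdef, ← hakdef, ← hΩ₀def] at h35
    have hbrS : (S.card : ℝ) * Real.exp (-(δ₀ * (((P.L : ℝ) ^ k)⁻¹ * (2 * R)))) + Real.exp (-(δ₀ / 2 * (((P.L : ℝ) ^ k)⁻¹ * R₁))) ≤ br := by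
      rw [hbrdef]
      have hSm' : (S.card : ℝ) ≤ m := by exact_mod_cast hSm
      exact add_le_add (mul_le_mul_of_nonneg_right hSm' (Real.exp_nonneg _)) le_rfl
    calc _ ≤ A * (ak * c₀ * ((S.card : ℝ) * Real.exp (-(δ₀ * (((P.L : ℝ) ^ k)⁻¹ * (2 * R)))) +
            Real.exp (-(δ₀ / 2 * (((P.L : ℝ) ^ k)⁻¹ * R₁)))) * Real.exp (-(δ₀ / 2 * B5Ineq137Torus.T P (0 + k) y₁ y₂))) := h35
      _ ≤ A * (ak * c₀ * br * Real.exp (-(δ₀ / 2 * B5Ineq137Torus.T P (0 + k) y₁ y₂))) := by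
          apply mul_le_mul_of_nonneg_left _ hA0.le
          apply mul_le_mul_of_nonneg_right _ (Real.exp_nonneg _)
          exact mul_le_mul_of_nonneg_left hbrS (mul_nonneg hak.le hc₀.le)
      _ = δ' * Real.exp (-(δ₀ / 2 * B5Ineq137Torus.T P (0 + k) y₁ y₂)) := by rw [hδ'def]; ring
  have hsymm : ∀ y₁ y₂ : Balaban1983to89.Site P (0 + k), B5Ineq137Torus.T P (0 + k) y₁ y₂ = B5Ineq137Torus.T P (0 + k) y₂ y₁ :=
    fun y₁ y₂ => T_symm P (0 + k) y₁ y₂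
  have hSrow : ∀ y₁ : Balaban1983to89.Site P (0 + k),
      ∑ y₂, Real.exp (-(δ₀ / 2) * B5Ineq137Torus.T P (0 + k) y₁ y₂) ≤ Kd := by
    intro y₁
    simp_rw [neg_mul]
    exact rowSum_T_le P (0 + k) (half_pos hδ₀) y₁
  -- p02's hence-step
  have h38 := ineq238_loc_of_kernelClose h238 hM hsymm hSrow hδ'0 φ hφ
  beta_reduce at h38
  rw [kform_eq_re_dotProduct] at h38
  -- constants
  have hconst : γA * (0 : ℝ) ^ 2 * (0 : ℝ) ^ 2 + δ' * Kd = A / ak * (ak ^ 2 * (c₀ * latticeConst (d + 1) (δ₀ / 2)) * br) := by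
    rw [hKdPd, hδ'def]
    field_simp
    ring
  rw [hconst, hγAdef] at h38
  calc A / ak * (min (ak / (8 * P.d)) (1 / 2) *
          ∑ b : PBond P (0 + k), ‖toC (h (cornerIter k b.src)) * (toC (h (cornerIter k b.tgt)))⁻¹ * φ b.tgt - φ b.src‖ ^ 2
        - ak ^ 2 * (c₀ * latticeConst (d + 1) (δ₀ / 2)) * br * ∑ y : Balaban1983to89.Site P (0 + k), ‖φ y‖ ^ 2)
      = A / ak * min (ak / (8 * P.d)) (1 / 2) *
          ∑ b : PBond P (0 + k), ‖toC (h (cornerIter k b.src)) * (toC (h (cornerIter k b.tgt)))⁻¹ * φ b.tgt - φ b.src‖ ^ 2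
        - A / ak * (ak ^ 2 * (c₀ * latticeConst (d + 1) (δ₀ / 2)) * br) * ∑ y : Balaban1983to89.Site P (0 + k), ‖φ y‖ ^ 2 := by
        ring
    _ ≤ _ := h38

/-- **(2.38) AT EVERY PURE-GAUGE BACKGROUND `u = 1^h` FOR GEN 15's `Δ_{k,loc}(1^h)` — p02's hence-step `ineq238_loc_of_kernelClose` BY
NAME on (I.7.3.2) for `Δ_k(Ω₀,1^h)` (§5, the no-wrap box `Ω₀` of gen 17's (2.35)) and gen 17's (2.35) `close235_flat_level`** (p. 264:
*"Finally, in view of (2.35), the lower bound (I.7.3.2) applies to Δ_{k,loc}(u) as well. Let φ be supported in a region having an r(e_k)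
neighborhood where u is smooth. Then ⟨φ, Δ_{k,loc}(u)φ⟩ ≧ c Σ_{b∈T₁^{(k)*}} |u(⟨b₋,b₊⟩)φ(b₊) − φ(b₋)|² − ce_k²p(e_k)² Σ_{x∈T₁^{(k)}} |φ(x)|².
(2.38)"*).  THERE EXIST `δ₀, c₁ > 0` depending on `(d, ℓ, a)` only such that for every volume (`P.d = d+1`, `P.L = ℓ+1`), every `1 ≤ k ≤ K`,
every no-wrap box `Ω₀ = c·L^k + Π_i[0, L^kM₀,i)` shorter than the torus, every finite family of cubes NESTED in `Ω₀` with weights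
`Σ_α|λ_α| ≤ 1` and cut-off `0 ≤ ζ″ ≤ 1` (DATA), every gauge transformation `h`, radii `R, R₁ ≥ 0`, multiplicity set `S`, and every
admissibility predicate `Adm` such that admissible `φ` satisfy gen 17's (2.35) row hypotheses (i)–(iii) + (S) on every block `B^k(y₁)`,
`y₁ ∈ supp φ`, and have every unit bond meeting `supp φ` inside `Ω₀^{(k)*}` (print: *"φ supported in a region having an r(e_k)
neighborhood where u is smooth"*): for every admissible `φ`,
`(A/a_k)·( min(a_k/(8d), ½)·Σ_{b∈T₁^{(k)*}} |u_k(b)φ(b₊) − φ(b₋)|² − a_k²·c₁·(#S·e^{−2δ₀R/L^k} + e^{−(δ₀/2)R₁/L^k})·Σ_x|φ(x)|² ) ≤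
⟨φ, Δ_{k,loc}(1^h)φ⟩`, with `u_k(b) = h(b₋)h(b₊)^{−1}` the transport of `1^h` along `b` and `A/a_k = L^{kd}(L^kε)^{−2}` the counting
normalization of gen 15's `deltaLocT` (gen 17: `deltaLocT = (A/a_k)×` the printed kernel) — i.e. the printed (2.38) at flat `u` with
`c = min(a_k/(8d), ½)` (≥ `min(a(1−L^{−2})/(8d), ½)` uniformly in `k`, `aSeq_ge`), the `e_k²p(e_k)²` term ZERO (no field strength) and the
(2.35) error `a_k²c₁e^{−cr(e_k)}` (at the printed radii `R, R₁ = r(e_k)L^k`) as the explicit second constant (p02's two-constant reading,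
HOME/GAPS.md).  `c₁ = c₀·K_{d}(δ₀/2)` with `c₀` the constant of `close235_flat_level` and `K_d` the torus row sum `rowSum_T_le`.
[cite: BalabanImbrieJaffe1988, (2.38) p.264] -/
theorem ineq238_flat (d ℓ : ℕ) (hℓ : 1 ≤ ℓ) {a : ℝ} (ha : 0 < a) :
    ∃ δ₀ c₁ : ℝ, 0 < δ₀ ∧ 0 < c₁ ∧ ∀ (P : Params) (hPd : P.d = d + 1), P.L = ℓ + 1 →
      ∀ k : ℕ, 1 ≤ k → k ≤ P.K → ∀ (c M0 : Fin (d + 1) → ℕ), (∀ i, 1 ≤ M0 i) →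
        (∀ i, c i * P.L ^ k + P.L ^ k * M0 i ≤ P.sitesPerDir 0) → (∀ i, P.L ^ k * M0 i < P.sitesPerDir 0) →
      ∀ (ι : Type) [Fintype ι] (cube : ι → Finset (Balaban1983to89.Site P 0))
        (lam : ι → Balaban1983to89.Site P 0 → Balaban1983to89.Site P 0 → ℝ)
        (ζ'' : Balaban1983to89.Site P 0 → Balaban1983to89.Site P 0 → ℝ),
        (∀ α, ∃ t M : Fin (d + 1) → ℕ, (∀ i, 1 ≤ M i) ∧ (∀ i, t i + M i ≤ M0 i) ∧
            cube α = cubeT hPd (P.L ^ k) (c + t) fun i => P.L ^ k * M i) →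
        (∀ x y, ∑ α, |lam α x y| ≤ 1) → (∀ x y, 0 ≤ ζ'' x y ∧ ζ'' x y ≤ 1) →
      ∀ (h : GaugeTransf P 0 U1) (R R₁ : ℝ), 0 ≤ R → 0 ≤ R₁ → ∀ (S : Finset ι)
        (Adm : (Balaban1983to89.Site P (0 + k) → ℂ) → Prop),
        (∀ φ, Adm φ → ∀ y₁, φ y₁ ≠ 0 →
          (∀ x ∈ blockK k y₁, ∀ y, ζ'' x y ≠ 0 → ∑ α, lam α x y = 1) ∧
          (∀ x ∈ blockK k y₁, ∀ α y, ζ'' x y * lam α x y ≠ 0 → x ∈ cube α ∧ y ∈ cube α ∧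
              ∀ w ∈ cubeT hPd (P.L ^ k) c (fun i => P.L ^ k * M0 i), w ∉ cube α →
                R ≤ B5Ineq137Torus.T P 0 x w ∧ R ≤ B5Ineq137Torus.T P 0 y w) ∧
          (∀ x ∈ blockK k y₁, ∀ y, B5Ineq137Torus.T P 0 x y ≤ R₁ → ζ'' x y = 1) ∧
          (∀ x ∈ blockK k y₁, ∀ α y, ζ'' x y * lam α x y ≠ 0 → α ∈ S)) →
        (∀ φ, Adm φ → ∀ b : PBond P (0 + k), (φ b.src ≠ 0 ∨ φ b.tgt ≠ 0) →
          b ∈ starB (innerK k (cubeT hPd (P.L ^ k) c fun i => P.L ^ k * M0 i))) →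
      ∀ φ, Adm φ →
        (B1RG242Torus.α P a k * (P.L : ℝ) ^ (k * P.d)) / B1.aSeq a P.L k *
          (min (B1.aSeq a P.L k / (8 * P.d)) (1 / 2) *
              ∑ b : PBond P (0 + k), ‖toC (h (cornerIter k b.src)) * (toC (h (cornerIter k b.tgt)))⁻¹ * φ b.tgt - φ b.src‖ ^ 2
            - B1.aSeq a P.L k ^ 2 * c₁ *
              (S.card * Real.exp (-(δ₀ * (((P.L : ℝ) ^ k)⁻¹ * (2 * R)))) + Real.exp (-(δ₀ / 2 * (((P.L : ℝ) ^ k)⁻¹ * R₁)))) *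
              ∑ y : Balaban1983to89.Site P (0 + k), ‖φ y‖ ^ 2)
        ≤ (star φ ⬝ᵥ (deltaLocT (B1RG242Torus.α P a k * (P.L : ℝ) ^ (k * P.d)) P.eps⁻¹ (gaugeAct h (1 : GaugeField P 0 U1)) k cube
            lam ζ'' *ᵥ φ)).re := by
  obtain ⟨δ₀, c₁, hδ₀, hc₁, H⟩ := ineq238_flat_mult d ℓ hℓ ha
  refine ⟨δ₀, c₁, hδ₀, hc₁, ?_⟩
  intro P hPd hPL k hk1 hkK c M0 hM0 hfit0 hN0 ι _ cube lam ζ hcube hlam hζ h R R₁ hR hR₁ S Adm hAdm hnb φ hφ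
  exact H P hPd hPL k hk1 hkK c M0 hM0 hfit0 hN0 ι cube lam ζ hcube hlam hζ h R R₁ hR hR₁ S.card Adm
    (fun ψ hψ y₁ hy₁ => by
      obtain ⟨h1, h2, h3, h4⟩ := hAdm ψ hψ y₁ hy₁
      exact ⟨h1, h2, h3, S, le_rfl, h4⟩) hnb φ hφ

end Flat238

end

end Literature.MathematicalPhysics.QuantumFieldTheory.BalabanImbrieJaffe1984to88.BIJ88Ineq238FlatTorus
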